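import Mathlib
import HarnessLib
import Summits.ValiantsHypothesis.ValiantsHypothesis.Theorems.KPlusLogSqLawWeakLiftingTowerGraftWronskianDevelopable

/-!
# Tower graft line — CONJECTURE W, NAMED (not asserted): `Z₊(W(u,v)) ≤ 2K − 4` for two real `K`-nomials on a common support

Definitions file for LINE (B) `Cruxes/WeakLifting/Lines/tower_graft.lean` (crux `WeakLifting` = stmt-ValiantsHypothesis-19561).  Hands
g9–g11 of leafhand-val-kpluslogsqlaw-1 isolated CONJECTURE W — the size-one sector of the inflection class law of the line, identified by
g10 with the case `k = 1` of the «conjecture on the `k`-th developable» of [cite: SedykhShapiro2005] (V. Sedykh, B. Shapiro, Int. J. Math.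
16 (2005) 1157–1173, §1) for the lacunary moment ARCS `x ↦ [x^{d₀} : … : x^{d_{K−1}}]`, `x > 0` (their Theorem A is the case `K = 4`
for CLOSED convex curves; the arc version is not in print).  This file only NAMES the statement so that partial results, a proof or a
refutation can cite it BY NAME (g10's recommendation R(ii), REQUESTS 2026-08-31T15:53Z); nothing is asserted.

* `ConjectureWAt K` — for every pair of real `K`-nomials `u = Σ uₗ X^{dₗ}`, `v = Σ vₗ X^{dₗ}` on a common strictly increasing support
  `d`, the Wronskian `W(u,v) = u v′ − u′ v` has at most `2K − 4` distinct positive zeros;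
* `ConjectureW` — `∀ K, ConjectureWAt K`;
* `conjectureWAt_of_le_three` — `K ≤ 3` holds (tree: `…WronskianDevelopable.card_posRoots_wronskian_fewnomial_le_of_le_three`);
  what is known at `K = 4` is in `…WronskianKFourAlternating` (g10: open only on the fully alternating Plücker cell) and the g11 files
  `…WronskianKFour{Levels,FifthZero,Quotients,LevelTables,Roots,Turning,Laps,Outside,Shape}` (shape of a counterexample); OPEN for
  `K ≥ 4`.

HONEST FRAMING: Conjecture W calibrates the line's constants at fixed rank; it is NOT a registered stub, does not imply S4/S4f/S5/S5ᴸ,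
TowerB, `WeakLifting`, Conjecture B, `MatrixDescartes` (18050) or `VP ≠ VNP`, and is not asserted here.  Seat: prover
leafhand-val-kpluslogsqlaw-1 g11, `--supports stmt-ValiantsHypothesis-19561 --as helper`.
-/

-- `Summit.ValiantsHypothesis.ValiantsHypothesis.…` repeats a component by the D-0017 layout
-- (single-conjunct summit), which the `dupNamespace` linter flags; the name is mandated.
set_option linter.dupNamespace false
set_option autoImplicit false

namespace Summit.ValiantsHypothesis.ValiantsHypothesis.Theorems.KPlusLogSqLaw.TowerGraft

open Polynomial Finset
open scoped BigOperators Polynomial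

namespace WronskianDevelopable

/-- **CONJECTURE W at `K` letters** (NAMED, not asserted): two real `K`-nomials on a common strictly increasing support have a
Wronskian with at most `2K − 4` distinct positive zeros.  [cite: SedykhShapiro2005, §1 (conjecture on the `k`-th developable, `k = 1`),
for the lacunary moment arcs; hands g9/g10 of this line] -/
def ConjectureWAt (K : ℕ) : Prop :=
  ∀ (u v : Fin K → ℝ) (d : Fin K → ℕ), StrictMono d →
    ((wronskian (∑ l, C (u l) * (X : ℝ[X]) ^ d l) (∑ l, C (v l) * (X : ℝ[X]) ^ d l)).roots.toFinset.filter
      (fun x => 0 < x)).card ≤ 2 * K - 4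

/-- **CONJECTURE W** (NAMED, not asserted): `ConjectureWAt K` for every `K`. -/
def ConjectureW : Prop := ∀ K : ℕ, ConjectureWAt K

/-- `K ≤ 3`: Conjecture W holds (Descartes on the pair-sum support; tree lemma). [folklore] -/
theorem conjectureWAt_of_le_three {K : ℕ} (hK : K ≤ 3) : ConjectureWAt K := by
  intro u v d _
  exact card_posRoots_wronskian_fewnomial_le_of_le_three hK u v d

end WronskianDevelopable

end Summit.ValiantsHypothesis.ValiantsHypothesis.Theorems.KPlusLogSqLaw.TowerGraft
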